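import Literature.NumberTheory.DiophantineGeometry.AbcShapeSubBox
import HarnessLib

/-!
# The geometry-of-numbers bound with index sets (BBLT Prop. 4.1, arXiv v2)

[BernertEtAl2024, Prop. 4.1 (arXiv v2)]: for any sets `I, I', I''` of shape variables, fix the
variables *off* these sets, write the equation as `a' x + b' y = c' z` in
`x = ∏_{i∈I} aᵢ^i, y = ∏_{i∈I'} bᵢ^i, z = ∏_{i∈I''} cᵢ^i` (pairwise coprime), count the primitive
`(x, y)` with `c' ∣ a'x + b'y` by the congruence-lattice box count
(`card_box_filter_coprime_congr_le`: `≤ 2 + 28 XY/c'`), and recover the variables in the sets from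
`(x, y, z)` up to `D^d` choices each. In explicit form (`AbcShapes.shapeCount_le_geometry_sets`):

> `B_d ≤ (∏_{i∉I} Xᵢ ∏_{i∉I'} Yᵢ ∏_{i∉I''} Zᵢ) · D^{3d} ·`
> `       (2 + 28 · W_I(2X) W_{I'}(2Y) / (c₃ · offVal_{I''}(Z)))`,

`W_I(2X) = ∏_{i∈I} (2Xᵢ)^{i+1}`, `offVal_{I''}(Z) = ∏_{i∉I''} Zᵢ^{i+1}`. With `∏ᵢ XᵢYᵢZᵢ ~ X^λ`
and `c₃ ∏ Zᵢ^{i+1} ~ X` this is the printed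
`X^λ/(∏_I Aᵢ ∏_{I'} Bᵢ ∏_{I''} Cᵢ) + X^{λ-1} ∏_I Aᵢ^{i-1} ∏_{I'} Bᵢ^{i-1} ∏_{I''} Cᵢ^{i-1}`
(up to `X^ε`); it supplies inequalities (6.5)–(6.9) of [BernertEtAl2024, Prop. 6.1]. The case
`I = I' = I'' = {linear variable}` is `AbcShapeCount.shapeCount_succ_le`. Theorems 1.2/1.3
(named facts of `AbcExceptionalSetBounds`) are NOT proved here.

## References

* [BernertEtAl2024] C. Bernert, T. Browning, J. D. Lichtman, J. Teräväinen, *Bounds on the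
  exceptional set in the abc conjecture*, arXiv:2410.12234v2, Proposition 4.1, (6.5)–(6.9).
-/

noncomputable section

open Finset

namespace Literature.NumberTheory.DiophantineGeometry

namespace AbcShapes

/-- `V(x) = offVal_S(x) · W_S(x)`. [folklore] -/
theorem shapeVal_eq_offVal_mul_onVal {d : ℕ} (S : Finset (Fin d)) (x : Fin d → ℕ) :
    shapeVal x = offVal S x * onVal S x := by
  have h : mergeOn S x x = x := funext fun i => by simp [mergeOn]
  rw [← shapeVal_mergeOn S x x, h]

/-- `offVal_S` only depends on the coordinates off `S`: it is unchanged by freezing `S`.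
[folklore] -/
theorem offVal_freezeOn {d : ℕ} (S : Finset (Fin d)) (X x : Fin d → ℕ) :
    offVal S (freezeOn S X x) = offVal S x :=
  prod_congr rfl fun i hi => by rw [mem_compl] at hi; simp [freezeOn, hi]

/-- `W_S` only depends on the coordinates in `S`: it is unchanged by freezing `Sᶜ`. [folklore] -/
theorem onVal_freezeOn_compl {d : ℕ} (S : Finset (Fin d)) (X x : Fin d → ℕ) :
    onVal S (freezeOn Sᶜ X x) = onVal S x :=
  prod_congr rfl fun i hi => by simp [freezeOn, mem_compl, hi]

/-- `W_S` is monotone in the tuple. [folklore] -/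
theorem onVal_mono {d : ℕ} (S : Finset (Fin d)) {u v : Fin d → ℕ} (h : ∀ i, u i ≤ v i) :
    onVal S u ≤ onVal S v :=
  prod_le_prod (fun _ _ => Nat.zero_le _) fun i _ => Nat.pow_le_pow_left (h i) _

/-- **Geometry-of-numbers bound with index sets** [BernertEtAl2024, Prop. 4.1 (arXiv v2)],
explicit form: for `cᵢ ≥ 1`, boxes with positive parameters, sets `I, J, K` of coordinates, and
`D` with `τ(m) ≤ D` for `1 ≤ m ≤ T`, `T ≥ cᵢ ∏ (2·)^{i+1}`:
`B_d ≤ (∏_{i∉I} Xᵢ)(∏_{i∉J} Yᵢ)(∏_{i∉K} Zᵢ) · D^{3d} · (2 + 28 W_I(2X) W_J(2Y)/(c₃ offVal_K(Z)))`.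
[cite: BernertEtAl2024, Proposition 4.1 (arXiv v2)] -/
theorem shapeCount_le_geometry_sets {d : ℕ} {c₁ c₂ c₃ : ℕ} (hc₁ : 0 < c₁) (hc₂ : 0 < c₂)
    (hc₃ : 0 < c₃) (X Y Z : Fin d → ℕ) (hX : ∀ i, 0 < X i) (hY : ∀ i, 0 < Y i) (hZ : ∀ i, 0 < Z i)
    (I J K : Finset (Fin d)) {T D : ℕ}
    (hTX : c₁ * shapeVal (fun i => 2 * X i) ≤ T) (hTY : c₂ * shapeVal (fun i => 2 * Y i) ≤ T)
    (hTZ : c₃ * shapeVal (fun i => 2 * Z i) ≤ T)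
    (hD : ∀ m : ℕ, m ≠ 0 → m ≤ T → m.divisors.card ≤ D) :
    (shapeCount c₁ c₂ c₃ X Y Z : ℝ) ≤
      ((subBox I X).card * (subBox J Y).card * (subBox K Z).card : ℕ) * (D : ℝ) ^ (3 * d) *
        (2 + 28 * (onVal I (fun i => 2 * X i) : ℝ) * (onVal J (fun i => 2 * Y i)) /
          ((c₃ * offVal K Z : ℕ) : ℝ)) := by
  classical
  set F := shapeTriples c₁ c₂ c₃ X Y Z with hF
  set O := subBox I X ×ˢ subBox J Y ×ˢ subBox K Z with hO
  set N₁ : ℕ := onVal I (fun i => 2 * X i) with hN₁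
  set N₂ : ℕ := onVal J (fun i => 2 * Y i) with hN₂
  set φ : (Fin d → ℕ) × (Fin d → ℕ) × (Fin d → ℕ) → (Fin d → ℕ) × (Fin d → ℕ) × (Fin d → ℕ) :=
    fun t => (freezeOn I X t.1, freezeOn J Y t.2.1, freezeOn K Z t.2.2) with hφ
  have hmaps : Set.MapsTo φ (F : Set _) (O : Set _) := by
    intro t ht
    obtain ⟨hbox, -⟩ := mem_filter.mp (mem_coe.mp ht)
    simp only [mem_product] at hbox
    exact mem_coe.mpr (mem_product.mpr ⟨freezeOn_mem_subBox I hbox.1,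
      mem_product.mpr ⟨freezeOn_mem_subBox J hbox.2.1, freezeOn_mem_subBox K hbox.2.2⟩⟩)
  -- general facts
  have hD1 : 1 ≤ D := by
    have h1 : (1 : ℕ) ≤ T := le_trans (Nat.mul_pos hc₃ (shapeVal_pos fun i => by have := hZ i; omega)) hTZ
    simpa using hD 1 one_ne_zero h1
  have hval : ∀ {c : ℕ} {W w : Fin d → ℕ} (S : Finset (Fin d)), 0 < c → (∀ i, 0 < W i) →
      c * shapeVal (fun i => 2 * W i) ≤ T → w ∈ dyadicBox W →
      onVal S w ≠ 0 ∧ onVal S w ≤ T ∧ (onVal S w).divisors.card ≤ D := by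
    intro c W w S hc hW hTW hw
    have hwpos : ∀ i, 0 < w i := fun i => lt_of_lt_of_le (hW i) ((mem_dyadicBox.mp hw) i).1
    have h0 : 0 < onVal S w := prod_pos fun i _ => pow_pos (hwpos i) _
    have hle : onVal S w ≤ T := by
      calc onVal S w ≤ offVal S w * onVal S w := Nat.le_mul_of_pos_left _
              (prod_pos fun i _ => pow_pos (hwpos i) _)
        _ = shapeVal w := (shapeVal_eq_offVal_mul_onVal S w).symm
        _ ≤ shapeVal (fun i => 2 * W i) := shapeVal_mono fun i => ((mem_dyadicBox.mp hw) i).2.le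
        _ ≤ c * shapeVal (fun i => 2 * W i) := Nat.le_mul_of_pos_left _ hc
        _ ≤ T := hTW
    exact ⟨h0.ne', hle, hD _ h0.ne' hle⟩
  set Bnd : ℝ := (D : ℝ) ^ (3 * d) * (2 + 28 * (N₁ : ℝ) * N₂ / ((c₃ * offVal K Z : ℕ) : ℝ)) with hBnd
  have hBnd0 : 0 ≤ Bnd := by positivity
  /- the bound on one fibre -/
  have hfib : ∀ o ∈ O, ((F.filter (fun t => φ t = o)).card : ℝ) ≤ Bnd := by
    rintro ⟨ox, oy, oz⟩ ho
    set Fo := F.filter (fun t => φ t = (ox, oy, oz)) with hFo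
    rcases Fo.eq_empty_or_nonempty with he | ⟨t₀, ht₀⟩
    · rw [he, card_empty, Nat.cast_zero]; exact hBnd0
    simp only [hO, mem_product] at ho
    obtain ⟨hox, hoy, hoz⟩ := ho
    -- the coefficients
    set a' : ℕ := c₁ * offVal I ox with ha'
    set b' : ℕ := c₂ * offVal J oy with hb'
    set c' : ℕ := c₃ * offVal K oz with hc'
    have hozpos : ∀ i, 0 < oz i := fun i => lt_of_lt_of_le (hZ i) ((mem_dyadicBox.mp (subBox_subset hZ hoz)) i).1
    have hc'pos : 0 < c' := Nat.mul_pos hc₃ (prod_pos fun i _ => pow_pos (hozpos i) _)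
    have hc'ge : c₃ * offVal K Z ≤ c' := by
      refine Nat.mul_le_mul_left _ (prod_le_prod (fun _ _ => Nat.zero_le _) fun i _ => ?_)
      exact Nat.pow_le_pow_left ((mem_dyadicBox.mp (subBox_subset hZ hoz)) i).1 _
    -- what membership in the fibre means
    have hmem : ∀ t ∈ Fo, (t.1 ∈ dyadicBox X ∧ t.2.1 ∈ dyadicBox Y ∧ t.2.2 ∈ dyadicBox Z) ∧
        freezeOn I X t.1 = ox ∧ freezeOn J Y t.2.1 = oy ∧ freezeOn K Z t.2.2 = oz ∧
        (a' : ℤ) * onVal I t.1 + (b' : ℤ) * onVal J t.2.1 = (c' : ℤ) * onVal K t.2.2 ∧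
        Nat.Coprime (c₁ * shapeVal t.1) (c₂ * shapeVal t.2.1) := by
      intro t ht
      obtain ⟨htF, hφt⟩ := mem_filter.mp ht
      have hcop := coprime_terms_of_mem htF
      obtain ⟨hbox, heq, -⟩ := mem_filter.mp htF
      simp only [hφ, Prod.mk.injEq] at hφt
      obtain ⟨h1, h2, h3⟩ := hφt
      refine ⟨by simpa only [mem_product] using hbox, h1, h2, h3, ?_, hcop⟩
      rw [shapeVal_eq_offVal_mul_onVal I t.1, shapeVal_eq_offVal_mul_onVal J t.2.1,
        shapeVal_eq_offVal_mul_onVal K t.2.2, ← offVal_freezeOn I X t.1, ← offVal_freezeOn J Y t.2.1,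
        ← offVal_freezeOn K Z t.2.2, h1, h2, h3] at heq
      rw [ha', hb', hc']
      push_cast
      have := congrArg (fun n : ℕ => (n : ℤ)) heq
      push_cast at this
      linear_combination this
    -- `gcd(a', b') = 1`
    obtain ⟨-, h01, h02, -, -, hcop0⟩ := hmem t₀ ht₀
    have hab : Nat.Coprime a' b' := by
      have hd1 : a' ∣ c₁ * shapeVal t₀.1 := by
        rw [shapeVal_eq_offVal_mul_onVal I, ← offVal_freezeOn I X, h01, ha']
        exact ⟨onVal I t₀.1, by ring⟩
      have hd2 : b' ∣ c₂ * shapeVal t₀.2.1 := by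
        rw [shapeVal_eq_offVal_mul_onVal J, ← offVal_freezeOn J Y, h02, hb']
        exact ⟨onVal J t₀.2.1, by ring⟩
      exact (hcop0.coprime_dvd_left hd1).coprime_dvd_right hd2
    have hv : Nat.Coprime (Int.gcd (a' : ℤ) (b' : ℤ)) c' := by
      rw [Int.gcd_natCast_natCast, hab]; exact Nat.coprime_one_left _
    -- the congruence-lattice set and its bound
    set L := ((Icc (-(N₁ : ℤ)) (N₁ : ℤ) ×ˢ Icc (-(N₂ : ℤ)) (N₂ : ℤ)).filter
      (fun w => Int.gcd w.1 w.2 = 1 ∧ (c' : ℤ) ∣ (a' : ℤ) * w.1 + (b' : ℤ) * w.2)) with hL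
    have hLcard : (L.card : ℝ) ≤ 2 + 28 * (N₁ : ℝ) * N₂ / c' :=
      card_box_filter_coprime_congr_le hc'pos hv N₁ N₂
    -- fibre the fibre over `(onVal I x, onVal J y) ∈ L`
    have hmapsL : Set.MapsTo (fun t : (Fin d → ℕ) × (Fin d → ℕ) × (Fin d → ℕ) =>
        ((onVal I t.1 : ℤ), (onVal J t.2.1 : ℤ))) (Fo : Set _) (L : Set _) := by
      intro t ht
      obtain ⟨⟨hbx, hby, -⟩, -, -, -, heq, hcop⟩ := hmem t (mem_coe.mp ht)
      have hxN : onVal I t.1 ≤ N₁ := onVal_mono I fun i => ((mem_dyadicBox.mp hbx) i).2.le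
      have hyN : onVal J t.2.1 ≤ N₂ := onVal_mono J fun i => ((mem_dyadicBox.mp hby) i).2.le
      have hcxy : Nat.Coprime (onVal I t.1) (onVal J t.2.1) := by
        have hd1 : onVal I t.1 ∣ c₁ * shapeVal t.1 := by
          rw [shapeVal_eq_offVal_mul_onVal I]; exact ⟨c₁ * offVal I t.1, by ring⟩
        have hd2 : onVal J t.2.1 ∣ c₂ * shapeVal t.2.1 := by
          rw [shapeVal_eq_offVal_mul_onVal J]; exact ⟨c₂ * offVal J t.2.1, by ring⟩
        exact (hcop.coprime_dvd_left hd1).coprime_dvd_right hd2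
      refine mem_coe.mpr (mem_filter.mpr ⟨?_, ?_, ⟨(onVal K t.2.2 : ℤ), heq⟩⟩)
      · dsimp only
        rw [mem_product, mem_Icc, mem_Icc]; refine ⟨⟨by omega, by omega⟩, by omega, by omega⟩
      · rw [Int.gcd_natCast_natCast]; exact hcxy
    rw [card_eq_sum_card_fiberwise hmapsL]
    push_cast
    -- each `(v₁, v₂)`-fibre has at most `D^{3d}` elements
    have hinner : ∀ w ∈ L, ((Fo.filter (fun t => ((onVal I t.1 : ℤ), (onVal J t.2.1 : ℤ)) = w)).card : ℝ)
        ≤ (D : ℝ) ^ (3 * d) := by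
      intro w hw
      rcases (Fo.filter (fun t => ((onVal I t.1 : ℤ), (onVal J t.2.1 : ℤ)) = w)).eq_empty_or_nonempty
        with he | ⟨t₁, ht₁⟩
      · rw [he, card_empty, Nat.cast_zero]; positivity
      -- the common values
      obtain ⟨ht₁F, ht₁w⟩ := mem_filter.mp ht₁
      obtain ⟨⟨hbx₁, hby₁, hbz₁⟩, -, -, -, heq₁, -⟩ := hmem t₁ ht₁F
      set v₁ := onVal I t₁.1 with hv₁
      set v₂ := onVal J t₁.2.1 with hv₂
      set v₃ := onVal K t₁.2.2 with hv₃
      obtain ⟨hv₁0, -, hv₁D⟩ := hval I hc₁ hX hTX hbx₁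
      obtain ⟨hv₂0, -, hv₂D⟩ := hval J hc₂ hY hTY hby₁
      obtain ⟨hv₃0, -, hv₃D⟩ := hval K hc₃ hZ hTZ hbz₁
      -- every `t` in this fibre has `onVal I x = v₁`, `onVal J y = v₂`, `onVal K z = v₃`
      have hvals : ∀ t ∈ Fo.filter (fun t => ((onVal I t.1 : ℤ), (onVal J t.2.1 : ℤ)) = w),
          onVal I t.1 = v₁ ∧ onVal J t.2.1 = v₂ ∧ onVal K t.2.2 = v₃ := by
        intro t ht
        obtain ⟨htF, htw⟩ := mem_filter.mp ht
        obtain ⟨-, -, -, -, heq, -⟩ := hmem t htF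
        have hww := htw.trans ht₁w.symm
        simp only [Prod.mk.injEq, Nat.cast_inj] at hww
        refine ⟨hww.1, hww.2, ?_⟩
        have : (c' : ℤ) * onVal K t.2.2 = (c' : ℤ) * onVal K t₁.2.2 := by
          rw [← heq, ← heq₁, hww.1, hww.2]
        exact_mod_cast mul_left_cancel₀ (by exact_mod_cast hc'pos.ne' : (c' : ℤ) ≠ 0) this
      -- inject into a product of three divisor-tuple sets
      have hinj : (Fo.filter (fun t => ((onVal I t.1 : ℤ), (onVal J t.2.1 : ℤ)) = w)).card ≤
          (((subBox Iᶜ X).filter (fun s => onVal I s = v₁)) ×ˢ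
            (((subBox Jᶜ Y).filter (fun s => onVal J s = v₂)) ×ˢ
              ((subBox Kᶜ Z).filter (fun s => onVal K s = v₃)))).card := by
        refine card_le_card_of_injOn
          (fun t => (freezeOn Iᶜ X t.1, freezeOn Jᶜ Y t.2.1, freezeOn Kᶜ Z t.2.2))
          (fun t ht => ?_) (fun t ht t' ht' h => ?_)
        · have ht' := mem_coe.mp ht
          obtain ⟨e1, e2, e3⟩ := hvals t ht'
          obtain ⟨⟨hbx, hby, hbz⟩, -, -, -, -, -⟩ := hmem t (mem_filter.mp ht').1
          refine mem_coe.mpr (mem_product.mpr ⟨mem_filter.mpr ⟨freezeOn_mem_subBox Iᶜ hbx, ?_⟩,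
            mem_product.mpr ⟨mem_filter.mpr ⟨freezeOn_mem_subBox Jᶜ hby, ?_⟩,
              mem_filter.mpr ⟨freezeOn_mem_subBox Kᶜ hbz, ?_⟩⟩⟩)
          · rw [onVal_freezeOn_compl, e1]
          · rw [onVal_freezeOn_compl, e2]
          · rw [onVal_freezeOn_compl, e3]
        · obtain ⟨-, f1, f2, f3, -, -⟩ := hmem t (mem_filter.mp (mem_coe.mp ht)).1
          obtain ⟨-, f1', f2', f3', -, -⟩ := hmem t' (mem_filter.mp (mem_coe.mp ht')).1
          simp only [Prod.mk.injEq] at h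
          obtain ⟨h1, h2, h3⟩ := h
          refine Prod.ext ?_ (Prod.ext ?_ ?_)
          · rw [← mergeOn_freezeOn I X t.1, ← mergeOn_freezeOn I X t'.1, f1, f1', h1]
          · rw [← mergeOn_freezeOn J Y t.2.1, ← mergeOn_freezeOn J Y t'.2.1, f2, f2', h2]
          · rw [← mergeOn_freezeOn K Z t.2.2, ← mergeOn_freezeOn K Z t'.2.2, f3, f3', h3]
      have hfac : ∀ (S : Finset (Fin d)) (W : Fin d → ℕ) {v : ℕ}, v ≠ 0 → v.divisors.card ≤ D →
          ((subBox Sᶜ W).filter (fun s => onVal S s = v)).card ≤ D ^ d := by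
        intro S W v hv0 hvD
        refine (card_subBox_filter_dvd_le Sᶜ W hv0 _ fun s _ hs i hi => ?_).trans
          (Nat.pow_le_pow_left hvD d)
        rw [← hs]; exact dvd_onVal S s (by rwa [mem_compl, not_not] at hi)
      calc _ ≤ ((((subBox Iᶜ X).filter (fun s => onVal I s = v₁)) ×ˢ
            (((subBox Jᶜ Y).filter (fun s => onVal J s = v₂)) ×ˢ
              ((subBox Kᶜ Z).filter (fun s => onVal K s = v₃)))).card : ℝ) := by exact_mod_cast hinj
        _ ≤ ((D ^ d * (D ^ d * D ^ d) : ℕ) : ℝ) := by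
            rw [card_product, card_product]
            exact_mod_cast Nat.mul_le_mul (hfac I X hv₁0 hv₁D)
              (Nat.mul_le_mul (hfac J Y hv₂0 hv₂D) (hfac K Z hv₃0 hv₃D))
        _ = (D : ℝ) ^ (3 * d) := by push_cast; ring
    calc ∑ w ∈ L, ((Fo.filter (fun t => ((onVal I t.1 : ℤ), (onVal J t.2.1 : ℤ)) = w)).card : ℝ)
        ≤ ∑ w ∈ L, (D : ℝ) ^ (3 * d) := sum_le_sum hinner
      _ = L.card * (D : ℝ) ^ (3 * d) := by rw [sum_const, nsmul_eq_mul]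
      _ ≤ (2 + 28 * (N₁ : ℝ) * N₂ / c') * (D : ℝ) ^ (3 * d) :=
          mul_le_mul_of_nonneg_right hLcard (by positivity)
      _ ≤ (2 + 28 * (N₁ : ℝ) * N₂ / ((c₃ * offVal K Z : ℕ) : ℝ)) * (D : ℝ) ^ (3 * d) := by
          have h0 : (0 : ℝ) < ((c₃ * offVal K Z : ℕ) : ℝ) := by
            exact_mod_cast Nat.mul_pos hc₃ (prod_pos fun i _ => pow_pos (hZ i) _)
          gcongr
      _ = Bnd := by rw [hBnd]; ring
  /- summing over the fibres -/
  calc (shapeCount c₁ c₂ c₃ X Y Z : ℝ) = (F.card : ℝ) := rfl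
    _ = ∑ o ∈ O, ((F.filter (fun t => φ t = o)).card : ℝ) := by
        rw [card_eq_sum_card_fiberwise hmaps]; push_cast; rfl
    _ ≤ ∑ o ∈ O, Bnd := sum_le_sum hfib
    _ = O.card * Bnd := by rw [sum_const, nsmul_eq_mul]
    _ = _ := by rw [hO, card_product, card_product, hBnd]; push_cast; ring

end AbcShapes

end Literature.NumberTheory.DiophantineGeometry
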